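import Summits.BirchSwinnertonDyer.BirchSwinnertonDyer.Theorems.EisensteinPrimesResidualIndexModuleData
import Summits.BirchSwinnertonDyer.Rank1Residual.X2.NonPrimitiveSelmerCorank
import Summits.BirchSwinnertonDyer.Rank1Residual.X2.NonPrimitiveQuotientCorank
import Literature.NumberTheory.EllipticCurves.KellerYin2024.CharacterSelmerGroups
import Literature.NumberTheory.EllipticCurves.H1TrivialAction
import HarnessLib

/-!
# Route `EisensteinPrimes`, crux 2 `GoodLatticeBDPValue` (stmt-BirchSwinnertonDyer-19032), line `halves` v20, stub
# `stub_indexPlumbing` part (B): UNRAMIFIED versus STRICT at `v̄` over `K_∞` —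
# `corank_{ℤ_p} H¹_{𝓕_nr^{S₀}}(K_∞, M) ≤ corank_{ℤ_p} H¹_{𝓕_Gr^{S₀}}(K_∞, M) + p^c · corank_{ℤ_p} M`
# when `Gal(K̄_v̄/K_{∞,v̄})` acts trivially on `M` (the `𝟙̃`-half «`+ s`» of step (8) of the V21 index road, `≤` direction)

Cell `bsd-eis` (home `run/shared/lean/pub/bsd-eis/`), width seat `bsd-line-x1-p1-w8` («width 8»; `--supports -19032`,
closes nothing). Keller–Yin arXiv:2402.12781v2 §1.4 (TeX L1240–1260) with Rem. 1.2.2: for the quotient character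
`𝟙̃ = θquot` of the residual pair, whose restriction to `G_{v̄}` is TRIVIAL, the unramified and the strict (Greenberg /
Castella) conditions at the places `w ∣ v̄` of `K_∞` differ by `ker(H¹(K_{∞,w}, F/𝒪) → H¹(I_w, F/𝒪)) = Hom_cont(G_w/I_w, F/𝒪)`,
one copy of (a subgroup of) `F/𝒪` per place. In the LEAD's v20 skeleton (`Cruxes/GoodLatticeBDPValue/Lines/halves.lean`,
STATUS 2026-08-28 l.3311) this is the «nr-vs-str at `v̄` (`+p^c` for `θquot`)» clause of `stub_indexPlumbing`; the
road memo is `Cruxes/GoodLatticeBDPValue/Lines/halves-imprimLambda-index-road.md` §2 (8).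

In the tree's currency (`KellerYin2024.unrSelmer κ M v̄ S₀ = datumSelmerInfty κ M (bdpData M p v̄) S₀` and
`grSelmer = datumStrictSelmer (ker κ) M p (bdpData M p v̄) S₀`, both by `rfl`), with `G = ker κ ⊓ D_v̄`,
`N = I_v̄ ⊓ G` (as `(inertia v̄).subgroupOf G`) and `L := ker(H¹(G, M) → H¹(N, M))` (`subgroupResKer`):

* §1 `resOfLe_mem_subgroupResKer_iff_mem_unramifiedKer` — the unramified condition at the chosen place, read on `G`;
  `resOfLe_conjH1_mem_subgroupResKer_of_mem_unrSelmer` — every conjugate of a class of `H¹_{𝓕_nr^{S₀}}` restricts into `L`;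
  `mem_grSelmer_iff_of_mem_unrSelmer` — with representatives `τ i` (`i < p^c`) controlling the strict condition
  (hypothesis `hreps`, the shape of v20's `stub_indexInputs` / x2-p2's `exists_reps_distinct_places`), a class of
  `H¹_{𝓕_nr^{S₀}}` lies in `H¹_{𝓕_Gr^{S₀}}` iff its `p^c` conjugates die on `G`.
* §2 `eq_zero_of_mem_subgroupResKer_of_evalH1_eq_zero` — if `G` acts TRIVIALLY on `M` and `γ ∈ G` generates `G`
  topologically modulo `N` (hypothesis `hgen`; supplied for `κ` ramified at `v̄` by w2 gen 3's
  `AnomalousLocalTorsion.exists_generator_decomp_inf_kerSubgroup`, transported to `ker κ ⊓ D_v̄` in the sequel file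
  `…IndexPlumbingNrVsStrictAtVbar`), a class of `L` vanishing at `γ` is zero: **`L ↪ M`** (evaluation at `γ`).
* §3 **`zpCorank_unrSelmer_le_zpCorank_grSelmer_add`** — for `M` `p`-primary with finite `M[p]`, `G` trivial on `M`,
  a topological generator of `G` modulo `N` (`hgen`) and `H¹_{𝓕_nr^{S₀}}[p]` finite:
  `zpCorank H¹_{𝓕_nr^{S₀}} ≤ zpCorank H¹_{𝓕_Gr^{S₀}} + p^c · zpCorank M` (additivity of `zpCorank` along
  `0 → Gr → nr → nr/Gr → 0` and the injection `nr/Gr ↪ ∏_{i<p^c} L ↪ M^{p^c}`); the character instance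
  **`zpCorank_unrSelmer_le_zpCorank_grSelmer_add_pow_charModule`** (`M = (F/𝒪)(θ)`, `corank 1`) and its `λ`-form
  **`lambdaInvariant_le_zpCorank_grSelmer_add_pow`** for any dual datum of `H¹_{𝓕_nr^{S₀}}(K_∞, (F/𝒪)(θ))` that is
  finitely generated torsion with `μ = 0` — the input «`λ(DSquot.X) ≤ zpCorank R((F/𝒪)(θquot)) + p^c`» of the `≤` form
  of `stub_indexPlumbing` (the consumer `GoodLatticeBDPValueOfLambdaIdentityTorsD.thm151ConclusionLE_of_lambdaTD_at`
  uses the `λ`-identity only in this direction).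

What is NOT here: the reverse inequality («`= p^c`»: surjectivity onto `∏ L` from SUR, and `corank L = 1`, which needs an
unramified `ℤ_p`-quotient of `Gal(k̄/k_w)` — not in the tree); the anomalous input «`θquot|_{D_v̄} = 𝟙`» itself (w6's
`IndexInputsH0.smul_charModule_eq_of_mem_decomp`, taken here as the hypothesis `htriv`).

HONEST FRAMING: helper theorems only (0 definitions, 0 named facts, 0 sorry); no summit statement, no BSD / IMC2 / KY
Thm 1.4.1 (iii) is proved; 0 stubs / cells / labels move. References: [KellerYin2024] §1.2 Def. (1)–(4), Rem. 1.2.2,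
§1.4 (arXiv:2402.12781v2 TeX L1240–1260); [Greenberg1989] §1 p. 98 («replace `I_v` by `D_v`»); [GreenbergVatsal2000] §2
pp. 15–17, 20; [SerreGaloisCohomology1997] I §2.3–2.5; [NeukirchSchmidtWingberg2008] (1.6.3).
-/

set_option autoImplicit false
-- the route's Theorems namespace repeats the summit name by design (D-0017 nested layout)
set_option linter.dupNamespace false

noncomputable section

open scoped Classical AddSubgroup

namespace Summit.BirchSwinnertonDyer.BirchSwinnertonDyer.Theorems.IndexPlumbingNrVsStrict

open Function NumberField IsDedekindDomain Field
  Literature.NumberTheory.EllipticCurves Literature.NumberTheory.EllipticCurves.GreenbergSelmer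
  Literature.NumberTheory.EllipticCurves.GreenbergVatsal2000 Literature.NumberTheory.GaloisRepresentations
  Literature.NumberTheory.EllipticCurves.KellerYin2024 Literature.NumberTheory.IwasawaTheory
  Summit.BirchSwinnertonDyer.Rank1Residual Summit.BirchSwinnertonDyer.Rank1Residual.X2.NonPrimitiveQuotientCorank

variable {K : Type} [Field K] [NumberField K] {p : ℕ} [hp : Fact p.Prime] (κ : ZpExtension K p)
  {M : Type} [AddCommGroup M] [DistribMulAction (absoluteGaloisGroup K) M] [TopologicalSpace M]
  [DiscreteTopology M]

/-! ## §1 The unramified condition at `v̄` read on `G = ker κ ⊓ D_v̄`, and the strict kernel -/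

section Kernel

omit hp in
/-- **The unramified condition at the chosen place above `v`, read on `H ⊓ D_v`**: for any `H ≤ Γ_K`, a class
`x ∈ H¹(H, M)` is unramified at the chosen place above `v` (`GreenbergVatsal2000.unramifiedKer`: dies on `H ⊓ I_v`) iff its
restriction to `H ⊓ D_v` dies on the inertia subgroup `I_v ⊓ (H ⊓ D_v)` (`subgroupResKer`). Both sides are the same
cocycle identity on the same elements of `Γ_K`. [cite: GreenbergVatsal2000, §2 p. 17] [cite: SerreGaloisCohomology1997, I §2.4] -/
theorem resOfLe_mem_subgroupResKer_iff_mem_unramifiedKer (H : Subgroup (absoluteGaloisGroup K))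
    (v : HeightOneSpectrum (𝓞 K)) (x : subgroupH1 H M) :
    resOfLe M (inf_le_left : H ⊓ decomp v ≤ H) x ∈
        subgroupResKer M ((inertia v).subgroupOf (H ⊓ decomp v)) ↔
      x ∈ GreenbergVatsal2000.unramifiedKer H M v := by
  obtain ⟨z, rfl⟩ := oneCocycleClass_surjective _ x
  rw [GreenbergVatsal2000.unramifiedKer, AddMonoidHom.mem_ker,
    CocycleCriteria.resH1Hom_oneCocycleClass_eq_zero_iff, resOfLe, resH1Hom_oneCocycleClass, subgroupResKer,
    resKer_eq_ker, AddMonoidHom.mem_ker, CocycleCriteria.resH1Hom_oneCocycleClass_eq_zero_iff]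
  constructor
  · rintro ⟨m, hm⟩
    refine ⟨m, fun y ↦ ?_⟩
    have hyH : ((y : decomp (K := K) v) : absoluteGaloisGroup K) ∈ H := ((mem_inertiaIn_iff H v _).1 y.2).1
    have hyI : ((y : decomp (K := K) v) : absoluteGaloisGroup K) ∈ inertia v := ((mem_inertiaIn_iff H v _).1 y.2).2
    let n : ↥((inertia v).subgroupOf (H ⊓ decomp (K := K) v)) :=
      ⟨⟨((y : decomp (K := K) v) : absoluteGaloisGroup K), Subgroup.mem_inf.2 ⟨hyH, (y : decomp (K := K) v).2⟩⟩,
        Subgroup.mem_subgroupOf.2 hyI⟩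
    have key := hm n
    rw [pullback_resHomOfEquivariant_apply, AddMonoidHom.id_apply, AddMonoidHom.id_apply] at key
    rw [AddMonoidHom.id_apply]
    have e : inertiaInToH H v y = subgroupInclusion (inf_le_left : H ⊓ decomp v ≤ H) (Literature.NumberTheory.EllipticCurves.subgroupIncl _ n) :=
      Subtype.ext rfl
    rw [e, key]
    rfl
  · rintro ⟨m, hm⟩
    refine ⟨m, fun n ↦ ?_⟩
    have hn := Subgroup.mem_inf.1 (n : ↥(H ⊓ decomp (K := K) v)).2
    have hnI : ((n : ↥(H ⊓ decomp (K := K) v)) : absoluteGaloisGroup K) ∈ inertia v := Subgroup.mem_subgroupOf.1 n.2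
    let y : inertiaIn H v :=
      ⟨⟨((n : ↥(H ⊓ decomp (K := K) v)) : absoluteGaloisGroup K), hn.2⟩, (mem_inertiaIn_iff H v _).2 ⟨hn.1, hnI⟩⟩
    have key := hm y
    rw [AddMonoidHom.id_apply] at key
    rw [pullback_resHomOfEquivariant_apply, AddMonoidHom.id_apply, AddMonoidHom.id_apply]
    have e : subgroupInclusion (inf_le_left : H ⊓ decomp v ≤ H) (Literature.NumberTheory.EllipticCurves.subgroupIncl _ n) = inertiaInToH H v y :=
      Subtype.ext rfl
    rw [e, key]
    rfl

variable (vbar : HeightOneSpectrum (𝓞 K)) (S₀ : Set (HeightOneSpectrum (𝓞 K)))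

/-- **Every conjugate of a class of `H¹_{𝓕_nr^{S₀}}(K_∞, M)` restricts into the unramified local kernel
`L = ker(H¹(ker κ ⊓ D_v̄, M) → H¹(I_v̄ ⊓ ker κ ⊓ D_v̄, M))`** (Greenberg's inertia condition for Castella's strict datum
`M⁺_v̄ = 0` IS the unramified condition, `CharResidualSelmerCount.mem_greenbergKer_strictDatum_iff`, imposed after every
conjugation). [cite: KellerYin2024, §1.2 Def. (3)–(4) (arXiv:2402.12781v2)] [cite: GreenbergVatsal2000, §2 p. 20] -/
theorem resOfLe_conjH1_mem_subgroupResKer_of_mem_unrSelmer (hvbar : ((p : ℕ) : 𝓞 K) ∈ vbar.asIdeal)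
    {u : subgroupH1 κ.kerSubgroup M} (hu : u ∈ unrSelmer κ M vbar S₀) (σ : absoluteGaloisGroup K) :
    resOfLe M (inf_le_left : κ.kerSubgroup ⊓ decomp vbar ≤ κ.kerSubgroup) (conjH1 κ.kerSubgroup M σ u) ∈
      subgroupResKer M ((inertia vbar).subgroupOf (κ.kerSubgroup ⊓ decomp vbar)) := by
  have h := ((mem_datumSelmer_iff _).1 hu).2 vbar hvbar σ
  rw [Castella2018.AcSelmer.bdpData_self p vbar hvbar, CharResidualSelmerCount.mem_greenbergKer_strictDatum_iff] at h
  exact (resOfLe_mem_subgroupResKer_iff_mem_unramifiedKer κ.kerSubgroup vbar _).2 h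

/-- **With representatives `τ i` (`i < p^c`) controlling the strict condition at every place above `v̄`, a class of
`H¹_{𝓕_nr^{S₀}}(K_∞, M)` lies in `H¹_{𝓕_Gr^{S₀}}(K_∞, M)` iff its `p^c` conjugates `conj_{τ i}` die on `ker κ ⊓ D_v̄`**
(the LEAD's `ResidualIndexModuleData.mem_datumStrictSelmer_iff_of_reps` on the unramified-outside-`S₀` class).
[cite: KellerYin2024, §1.2 Def. (1)–(4) (arXiv:2402.12781v2)] [cite: Castella2018, Def. 2.2 (arXiv:1704.06608 p. 5)] -/
theorem mem_grSelmer_iff_of_mem_unrSelmer (hvbar : ((p : ℕ) : 𝓞 K) ∈ vbar.asIdeal) (c : ℕ)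
    (τ : ℕ → absoluteGaloisGroup K)
    (hreps : ∀ x : subgroupH1 κ.kerSubgroup M,
      (∀ i, i < p ^ c → resOfLe M (inf_le_left : κ.kerSubgroup ⊓ decomp vbar ≤ κ.kerSubgroup)
        (conjH1 κ.kerSubgroup M (τ i) x) = 0) →
        ∀ σ : absoluteGaloisGroup K, resOfLe M (inf_le_left : κ.kerSubgroup ⊓ decomp vbar ≤ κ.kerSubgroup)
          (conjH1 κ.kerSubgroup M σ x) = 0)
    {u : subgroupH1 κ.kerSubgroup M} (hu : u ∈ unrSelmer κ M vbar S₀) :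
    u ∈ grSelmer κ M vbar S₀ ↔
      ∀ i : Fin (p ^ c), resOfLe M (inf_le_left : κ.kerSubgroup ⊓ decomp vbar ≤ κ.kerSubgroup)
        (conjH1 κ.kerSubgroup M (τ i) u) = 0 := by
  have hx : u ∈ unramifiedOutside κ.kerSubgroup M p S₀ := datumSelmer_le_unramifiedOutside _ _ _ _ _ hu
  exact ResidualIndexModuleData.mem_datumStrictSelmer_iff_of_reps κ.kerSubgroup S₀ vbar hvbar c τ hreps hx

end Kernel

/-! ## §2 The unramified local kernel embeds in `M` when `ker κ ⊓ D_v̄` acts trivially -/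

section Local

omit hp in
/-- **Evaluation at a topological generator is injective on the unramified local kernel** (trivial action): if a
(topological) group `G` acts trivially on the discrete module `M`, `N ≤ G`, and `γ ∈ G` lies in no proper open subgroup
containing `N`, then a class of `ker(H¹(G, M) → H¹(N, M))` whose cocycle ( = continuous homomorphism) vanishes at `γ`
is zero: its kernel is an open subgroup containing `N` and `γ`. (`H¹(G/N, M) = Hom_cont(G/N, M) ↪ M`, `f ↦ f(γ)`.)
[cite: SerreGaloisCohomology1997, I §2.3 (H¹ of a trivial module = Hom_cont)] [cite: NeukirchSchmidtWingberg2008, (1.6.3)] -/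
theorem eq_zero_of_mem_subgroupResKer_of_evalH1_eq_zero {G : Type} [Group G] [TopologicalSpace G]
    [IsTopologicalGroup G] {A : Type} [AddCommGroup A] [DistribMulAction G A] [TopologicalSpace A]
    [DiscreteTopology A] (htriv : ∀ (g : G) (a : A), g • a = a) (N : Subgroup G) {γ : G}
    (hgen : ∀ U : Subgroup G, IsOpen (U : Set G) → N ≤ U → γ ∈ U → U = ⊤)
    {η : discreteH1 G A} (hη : η ∈ subgroupResKer A N) (hγ : evalH1 htriv γ η = 0) : η = 0 := by
  set f := cocycleOf G A htriv η with hf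
  have hηf : oneCocycleClass (discreteTopRep G A) f = η := oneCocycleClass_cocycleOf htriv η
  -- `f` vanishes on `N`
  have hN : ∀ n ∈ N, f.1 n = 0 := by
    have h := hη
    rw [subgroupResKer, resKer_eq_ker, AddMonoidHom.mem_ker, ← hηf,
      CocycleCriteria.resH1Hom_oneCocycleClass_eq_zero_iff] at h
    obtain ⟨a, ha⟩ := h
    intro n hn
    have key := ha ⟨n, hn⟩
    rw [AddMonoidHom.id_apply, Literature.NumberTheory.EllipticCurves.subgroupIncl_apply] at key
    rw [key, Subgroup.smul_def, htriv, sub_self]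
  -- `f` vanishes at `γ`
  have hγf : f.1 γ = 0 := by
    rw [← hηf, evalH1_oneCocycleClass] at hγ
    exact hγ
  -- the kernel of `f` is an open subgroup containing `N` and `γ`
  have hmul : ∀ a b, f.1 (a * b) = f.1 a + f.1 b := cocycle_map_mul_of_trivial htriv f
  let S : Subgroup G :=
    { carrier := {g | f.1 g = 0}
      one_mem' := map_one_eq_zero_of_map_mul hmul
      mul_mem' := fun {a b} ha hb ↦ by
        change f.1 (a * b) = 0
        rw [hmul, ha, hb, add_zero]
      inv_mem' := fun {a} ha ↦ by
        change f.1 a⁻¹ = 0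
        rw [map_inv_eq_neg_of_map_mul' hmul, ha, neg_zero] }
  have hSopen : IsOpen (S : Set G) := isOpen_ker_of_continuous f.1.continuous
  have hNS : N ≤ S := fun n hn ↦ hN n hn
  have hγS : γ ∈ S := hγf
  have htop := hgen S hSopen hNS hγS
  have hzero : f = 0 := by
    apply Subtype.ext
    ext g
    have hg : g ∈ S := by rw [htop]; exact Subgroup.mem_top g
    exact hg
  rw [← hηf, hzero, oneCocycleClass_zero]

end Local

/-! ## §3 `corank H¹_{𝓕_nr^{S₀}} ≤ corank H¹_{𝓕_Gr^{S₀}} + p^c · corank M` -/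

section Corank

variable (vbar : HeightOneSpectrum (𝓞 K)) (S₀ : Set (HeightOneSpectrum (𝓞 K)))

/-- **UNRAMIFIED versus STRICT at `v̄` over `K_∞`, `≤` direction.** Let `M` be a discrete `p`-primary `Γ_K`-module with
finite `M[p]` on which `G = ker κ ⊓ D_v̄` acts TRIVIALLY (`θquot|_{G_v̄} = 𝟙`), `γ ∈ G` a topological generator modulo
the inertia subgroup (`hgen`: `κ` ramified at `v̄`), `τ i` (`i < p^c`) representatives controlling the strict condition above `v̄` (`hreps`), and assume `H¹_{𝓕_nr^{S₀}}(K_∞, M)[p]`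
finite. Then `corank_{ℤ_p} H¹_{𝓕_nr^{S₀}}(K_∞, M) ≤ corank_{ℤ_p} H¹_{𝓕_Gr^{S₀}}(K_∞, M) + p^c · corank_{ℤ_p} M`:
`corank` is additive along `0 → H¹_{𝓕_Gr} → H¹_{𝓕_nr} → Q → 0` (`zpCorank_eq_add_of_shortExact`) and
`Q ↪ ∏_{i<p^c} ker(H¹(G, M) → H¹(I ⊓ G, M)) ↪ M^{p^c}` (`u ↦ (f_{res conj_{τ i} u}(γ))_i`, §1–§2). KY §1.4: «nr versus
strict at `v̄`», the `s = p^c` copies of `H¹(G_w/I_w, F/𝒪)`. [cite: KellerYin2024, §1.4 (arXiv:2402.12781v2 TeX L1240–1260) and Rem. 1.2.2]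
[cite: Greenberg1989, §1 p. 98] [cite: GreenbergVatsal2000, §2 pp. 15, 20] -/
theorem zpCorank_unrSelmer_le_zpCorank_grSelmer_add (hvbar : ((p : ℕ) : 𝓞 K) ∈ vbar.asIdeal) (c : ℕ)
    (τ : ℕ → absoluteGaloisGroup K)
    (hreps : ∀ x : subgroupH1 κ.kerSubgroup M,
      (∀ i, i < p ^ c → resOfLe M (inf_le_left : κ.kerSubgroup ⊓ decomp vbar ≤ κ.kerSubgroup)
        (conjH1 κ.kerSubgroup M (τ i) x) = 0) →
        ∀ σ : absoluteGaloisGroup K, resOfLe M (inf_le_left : κ.kerSubgroup ⊓ decomp vbar ≤ κ.kerSubgroup)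
          (conjH1 κ.kerSubgroup M σ x) = 0)
    (htriv : ∀ (g : ↥(κ.kerSubgroup ⊓ decomp vbar)) (m : M), g • m = m)
    (hgen : ∃ γ : ↥(κ.kerSubgroup ⊓ decomp vbar),
      ∀ U : Subgroup ↥(κ.kerSubgroup ⊓ decomp vbar), IsOpen (U : Set ↥(κ.kerSubgroup ⊓ decomp vbar)) →
        (inertia vbar).subgroupOf (κ.kerSubgroup ⊓ decomp vbar) ≤ U → γ ∈ U → U = ⊤)
    (hM : ∀ m : M, ∃ n : ℕ, p ^ n • m = 0) [Finite (M[(p : ℤ)])]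
    [Finite ((↥(unrSelmer κ M vbar S₀))[(p : ℤ)])] :
    zpCorank ↥(unrSelmer κ M vbar S₀) p ≤ zpCorank ↥(grSelmer κ M vbar S₀) p + p ^ c * zpCorank M p := by
  -- notation
  set Unr := unrSelmer κ M vbar S₀ with hUnr
  set Gr := grSelmer κ M vbar S₀ with hGr
  have hle : Gr ≤ Unr := grSelmer_le_unrSelmer κ M vbar S₀
  have hprimU : ∀ u : ↥Unr, ∃ n : ℕ, p ^ n • u = 0 := fun u ↦ by
    obtain ⟨n, hn⟩ := GreenbergSelmer.exists_pow_smul_subgroupH1_eq_zero κ M hM (u : subgroupH1 κ.kerSubgroup M)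
    exact ⟨n, Subtype.ext (by rw [AddSubgroupClass.coe_nsmul]; exact hn)⟩
  -- additivity along `0 → Gr → Unr → Unr/Gr → 0`
  have hadd : zpCorank ↥Unr p = zpCorank ↥Gr p + zpCorank (↥Unr ⧸ Gr.addSubgroupOf Unr) p :=
    zpCorank_eq_add_of_shortExact (i := AddSubgroup.inclusion hle)
      (f := QuotientAddGroup.mk' (Gr.addSubgroupOf Unr)) (AddSubgroup.inclusion_injective hle)
      (QuotientAddGroup.mk'_surjective _)
      (fun b hb ↦ by
        have hb' : b ∈ Gr.addSubgroupOf Unr := (QuotientAddGroup.eq_zero_iff b).1 hb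
        exact ⟨⟨(b : subgroupH1 κ.kerSubgroup M), AddSubgroup.mem_addSubgroupOf.1 hb'⟩, Subtype.ext rfl⟩)
      (fun a ↦ (QuotientAddGroup.eq_zero_iff _).2 (AddSubgroup.mem_addSubgroupOf.2 (by
        rw [AddSubgroup.coe_inclusion]; exact a.2)))
      hprimU
  -- the generator and the map `Θ : Unr → M^{p^c}`, `u ↦ (f_{res conj_{τ i} u}(γ))_i`
  obtain ⟨γ, hgen⟩ := hgen
  let loc : ℕ → (subgroupH1 κ.kerSubgroup M →+ subgroupH1 (κ.kerSubgroup ⊓ decomp vbar) M) := fun i ↦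
    (resOfLe M (inf_le_left : κ.kerSubgroup ⊓ decomp vbar ≤ κ.kerSubgroup)).comp (conjH1 κ.kerSubgroup M (τ i))
  let Θ : ↥Unr →+ (Fin (p ^ c) → M) :=
    (AddMonoidHom.pi fun i : Fin (p ^ c) ↦ (evalH1 htriv γ).comp (loc i)).comp Unr.subtype
  have hΘ : ∀ (u : ↥Unr) (i : Fin (p ^ c)), Θ u i = evalH1 htriv γ (loc i u) := fun _ _ ↦ rfl
  -- `ker Θ = Gr`
  have hker : Θ.ker = Gr.addSubgroupOf Unr := by
    ext u
    rw [AddMonoidHom.mem_ker, AddSubgroup.mem_addSubgroupOf, hGr,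
      mem_grSelmer_iff_of_mem_unrSelmer κ vbar S₀ hvbar c τ hreps u.2]
    constructor
    · intro h i
      have hi : Θ u i = 0 := by rw [h]; rfl
      rw [hΘ] at hi
      exact eq_zero_of_mem_subgroupResKer_of_evalH1_eq_zero htriv _ hgen
        (resOfLe_conjH1_mem_subgroupResKer_of_mem_unrSelmer κ vbar S₀ hvbar u.2 (τ i)) hi
    · intro h
      funext i
      rw [hΘ, Pi.zero_apply]
      have hi : loc i u = 0 := h i
      rw [hi, map_zero]
  -- `Unr/Gr ↪ M^{p^c}`
  have hinj : Injective ((QuotientAddGroup.kerLift Θ).comp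
      (QuotientAddGroup.quotientAddEquivOfEq hker.symm).toAddMonoidHom) :=
    (QuotientAddGroup.kerLift_injective Θ).comp (QuotientAddGroup.quotientAddEquivOfEq hker.symm).injective
  haveI : ∀ _ : Fin (p ^ c), Finite (M[(p : ℤ)]) := fun _ ↦ inferInstance
  haveI : Finite ((Fin (p ^ c) → M)[(p : ℤ)]) := finite_torsionBy_pi
  have hQ : zpCorank (↥Unr ⧸ Gr.addSubgroupOf Unr) p ≤ zpCorank (Fin (p ^ c) → M) p :=
    zpCorank_le_of_injective _ hinj (primary_pi fun _ ↦ hM)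
  have hpi : zpCorank (Fin (p ^ c) → M) p = p ^ c * zpCorank M p := by
    rw [zpCorank_pi (fun _ ↦ hM), Finset.sum_const, Finset.card_univ, Fintype.card_fin, smul_eq_mul]
  omega

/-- **The character instance**: for `M = (F/𝒪)(θ)` (`corank_{ℤ_p} = 1`, finite `p`-torsion, `p`-primary) on which
`ker κ ⊓ D_v̄` acts trivially — the quotient character `θquot = 𝟙̃` of the residual pair at the good anomalous place, by
w6's `IndexInputsH0.smul_charModule_eq_of_mem_decomp` — and a topological generator of `ker κ ⊓ D_v̄` modulo inertia:
`corank_{ℤ_p} H¹_{𝓕_nr^{S₀}}(K_∞, (F/𝒪)(θ)) ≤ corank_{ℤ_p} H¹_{𝓕_Gr^{S₀}}(K_∞, (F/𝒪)(θ)) + p^c`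
(KY §1.4: `λ_nr(𝟙̃) = λ_str(𝟙̃) + s`, `≤` half). [cite: KellerYin2024, §1.4 (arXiv:2402.12781v2 TeX L1240–1260) and Rem. 1.2.2] -/
theorem zpCorank_unrSelmer_le_zpCorank_grSelmer_add_pow_charModule
    (θ : FramedGaloisRep K (padicCoeffIntegers (∅ : Set (PadicAlgCl p))) 1)
    (hvbar : ((p : ℕ) : 𝓞 K) ∈ vbar.asIdeal) (c : ℕ) (τ : ℕ → absoluteGaloisGroup K)
    (hreps : ∀ x : subgroupH1 κ.kerSubgroup (charModule (∅ : Set (PadicAlgCl p)) θ),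
      (∀ i, i < p ^ c → resOfLe (charModule (∅ : Set (PadicAlgCl p)) θ)
        (inf_le_left : κ.kerSubgroup ⊓ decomp vbar ≤ κ.kerSubgroup)
        (conjH1 κ.kerSubgroup (charModule (∅ : Set (PadicAlgCl p)) θ) (τ i) x) = 0) →
        ∀ σ : absoluteGaloisGroup K, resOfLe (charModule (∅ : Set (PadicAlgCl p)) θ)
          (inf_le_left : κ.kerSubgroup ⊓ decomp vbar ≤ κ.kerSubgroup)
          (conjH1 κ.kerSubgroup (charModule (∅ : Set (PadicAlgCl p)) θ) σ x) = 0)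
    (htriv : ∀ g ∈ decomp (K := K) vbar, ∀ x : charModule (∅ : Set (PadicAlgCl p)) θ, g • x = x)
    (hgen : ∃ γ : ↥(κ.kerSubgroup ⊓ decomp vbar),
      ∀ U : Subgroup ↥(κ.kerSubgroup ⊓ decomp vbar), IsOpen (U : Set ↥(κ.kerSubgroup ⊓ decomp vbar)) →
        (inertia vbar).subgroupOf (κ.kerSubgroup ⊓ decomp vbar) ≤ U → γ ∈ U → U = ⊤)
    [Finite ((↥(unrSelmer κ (charModule (∅ : Set (PadicAlgCl p)) θ) vbar S₀))[(p : ℤ)])] :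
    zpCorank ↥(unrSelmer κ (charModule (∅ : Set (PadicAlgCl p)) θ) vbar S₀) p ≤
      zpCorank ↥(grSelmer κ (charModule (∅ : Set (PadicAlgCl p)) θ) vbar S₀) p + p ^ c := by
  haveI : Finite ((charModule (∅ : Set (PadicAlgCl p)) θ)[(p : ℤ)]) :=
    IwasawaTwoVariable.finite_torsionBy_charModule θ
  have htriv' : ∀ (g : ↥(κ.kerSubgroup ⊓ decomp vbar)) (m : charModule (∅ : Set (PadicAlgCl p)) θ), g • m = m :=
    fun g m ↦ by
      rw [Subgroup.smul_def]
      exact htriv _ (Subgroup.mem_inf.1 g.2).2 m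
  have h := zpCorank_unrSelmer_le_zpCorank_grSelmer_add κ vbar S₀ hvbar c τ hreps htriv' hgen
    (GreenbergSelmer.exists_pow_smul_cofree_eq_zero (∅ : Set (PadicAlgCl p)) θ)
  rw [IwasawaTwoVariable.zpCorank_charModule, mul_one] at h
  exact h

/-- **The `λ`-form** (input «`λ(DSquot.X) ≤ zpCorank R((F/𝒪)(θquot)) + p^c`» of the `≤` form of `stub_indexPlumbing`):
for any Pontryagin-dual datum `DS` of `H¹_{𝓕_nr^{S₀}}(K_∞, (F/𝒪)(θ))` that is finitely generated `Λ`-torsion with `μ = 0`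
(so that `λ(DS.X) = corank_{ℤ_p} H¹_{𝓕_nr^{S₀}}` and `H¹_{𝓕_nr^{S₀}}[p]` is finite,
`X2.NonPrimitiveSelmerCorank.finite_torsionBy_and_zpCorank_eq_lambdaInvariant`), under the hypotheses of
`zpCorank_unrSelmer_le_zpCorank_grSelmer_add_pow_charModule`:
`λ(DS.X) ≤ corank_{ℤ_p} H¹_{𝓕_Gr^{S₀}}(K_∞, (F/𝒪)(θ)) + p^c`. [cite: KellerYin2024, Thm. 1.4.1 (iii) and §1.4 (arXiv:2402.12781v2 TeX L1087–1098, L1240–1260)]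
[cite: GreenbergLNM1716, §1 p. 60 (corank = λ of the dual)] -/
theorem lambdaInvariant_le_zpCorank_grSelmer_add_pow {γ : absoluteGaloisGroup K}
    (θ : FramedGaloisRep K (padicCoeffIntegers (∅ : Set (PadicAlgCl p))) 1)
    (hvbar : ((p : ℕ) : 𝓞 K) ∈ vbar.asIdeal) (c : ℕ) (τ : ℕ → absoluteGaloisGroup K)
    (hreps : ∀ x : subgroupH1 κ.kerSubgroup (charModule (∅ : Set (PadicAlgCl p)) θ),
      (∀ i, i < p ^ c → resOfLe (charModule (∅ : Set (PadicAlgCl p)) θ)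
        (inf_le_left : κ.kerSubgroup ⊓ decomp vbar ≤ κ.kerSubgroup)
        (conjH1 κ.kerSubgroup (charModule (∅ : Set (PadicAlgCl p)) θ) (τ i) x) = 0) →
        ∀ σ : absoluteGaloisGroup K, resOfLe (charModule (∅ : Set (PadicAlgCl p)) θ)
          (inf_le_left : κ.kerSubgroup ⊓ decomp vbar ≤ κ.kerSubgroup)
          (conjH1 κ.kerSubgroup (charModule (∅ : Set (PadicAlgCl p)) θ) σ x) = 0)
    (htriv : ∀ g ∈ decomp (K := K) vbar, ∀ x : charModule (∅ : Set (PadicAlgCl p)) θ, g • x = x)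
    (hgen : ∃ γ : ↥(κ.kerSubgroup ⊓ decomp vbar),
      ∀ U : Subgroup ↥(κ.kerSubgroup ⊓ decomp vbar), IsOpen (U : Set ↥(κ.kerSubgroup ⊓ decomp vbar)) →
        (inertia vbar).subgroupOf (κ.kerSubgroup ⊓ decomp vbar) ≤ U → γ ∈ U → U = ⊤)
    (DS : DatumDualData κ γ (charModule (∅ : Set (PadicAlgCl p)) θ)
      (Castella2018.AcSelmer.bdpData (charModule (∅ : Set (PadicAlgCl p)) θ) p vbar) S₀)
    [Module.Finite (IwasawaAlgebra p) DS.X] (htor : Module.IsTorsion (IwasawaAlgebra p) DS.X)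
    (hμ : muInvariant p DS.X = 0) :
    lambdaInvariant p DS.X ≤
      zpCorank ↥(grSelmer κ (charModule (∅ : Set (PadicAlgCl p)) θ) vbar S₀) p + p ^ c := by
  have hprimU : ∀ u : ↥(unrSelmer κ (charModule (∅ : Set (PadicAlgCl p)) θ) vbar S₀), ∃ n : ℕ, p ^ n • u = 0 :=
    fun u ↦ by
      obtain ⟨n, hn⟩ := GreenbergSelmer.exists_pow_smul_subgroupH1_eq_zero κ (charModule (∅ : Set (PadicAlgCl p)) θ)
        (GreenbergSelmer.exists_pow_smul_cofree_eq_zero (∅ : Set (PadicAlgCl p)) θ)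
        (u : subgroupH1 κ.kerSubgroup (charModule (∅ : Set (PadicAlgCl p)) θ))
      exact ⟨n, Subtype.ext (by rw [AddSubgroupClass.coe_nsmul]; exact hn)⟩
  obtain ⟨hfin, hcork⟩ :=
    X2.NonPrimitiveSelmerCorank.finite_torsionBy_and_zpCorank_eq_lambdaInvariant p DS.X htor hμ hprimU DS.toDualEquiv
  haveI := hfin
  rw [← hcork]
  exact zpCorank_unrSelmer_le_zpCorank_grSelmer_add_pow_charModule κ vbar S₀ θ hvbar c τ hreps htriv hgen

end Corank

end Summit.BirchSwinnertonDyer.BirchSwinnertonDyer.Theorems.IndexPlumbingNrVsStrict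

end
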